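import Summits.PneNP.PneNP.Theses.DescentTower
import Literature.ModelTheory.FiniteModelTheory.CPTCardProgram

/-!
# Line `capturehom-cpt` — skeleton for piece `CaptureHom` (split of `ThreeColNotInP`, stmt-PneNP-2536)

CPT NORMAL FORM for homomorphism-monotone refuters. Two registered stubs and the kernel-checked
composition `CaptureHom_of`:

* `stub_cptDefinesHomRefuters` — CPT+Card (Blass–Gurevich–Shelah bounded BGS programs with `Card`,
  tree notion `CPTCardDefinable`) DEFINES every homomorphism-monotone polynomial-time class of
  non-3-colourable graphs (a hom-closed, one-sided restriction of the BGS question "CPT+Card = P?").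
* `stub_cptRefutersDominated` — every CPT+Card-definable, homomorphism-monotone class of
  non-3-colourable graphs is dominated by a sublinear coupled SOS⋈ℤ level (the level of crux B,
  inlined verbatim).
* `CaptureHom_of : Registered.stub_cptDefinesHomRefuters → Registered.stub_cptRefutersDominated → CaptureHom`
  — kernel-checked composition; the `Registered.stub_*` abbrevs key the stub STATEMENTS by the stub names
  (device of `Cruxes/Capture/Lines/csp-spine-meet-to-join.lean`) for the native skeleton audit.
-/

set_option linter.dupNamespace false

namespace Summit.PneNP.PneNP.Cruxes.CaptureHom.CptNormalForm

open Filter Literature.ModelTheory.FiniteModelTheory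

/-! ## The two stub statements -/

/-- Statement of STUB 1 (capture, XL, open): CPT+Card defines every homomorphism-monotone sound polynomial-time
refuter of 3-colourability, as a class of finite graphs. -/
def CptDefinesHomRefuters : Prop :=
    ∀ R : Language Bool, R ∈ Literature.Computability.Complexity.Classes.P →
      (∀ (n : ℕ) (G : SimpleGraph (Fin n)),
        Literature.Computability.Complexity.encodingGraph.encode ⟨n, G⟩ ∈ R → ¬ G.Colorable 3) →
      (∀ (n m : ℕ) (G : SimpleGraph (Fin n)) (H : SimpleGraph (Fin m)), Nonempty (G →g H) →
        Literature.Computability.Complexity.encodingGraph.encode ⟨n, G⟩ ∈ R →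
        Literature.Computability.Complexity.encodingGraph.encode ⟨m, H⟩ ∈ R) →
      CPTCardDefinable {G : FinGraph | Literature.Computability.Complexity.encodingGraph.encode G ∈ R}

/-- Statement of STUB 2 (domination of definable refuters, XL, open): a CPT+Card-definable,
homomorphism-monotone class of non-3-colourable graphs is dominated by a sublinear coupled level. -/
def CptRefutersDominated : Prop :=
    ∀ C : Set FinGraph, CPTCardDefinable C → (∀ G ∈ C, ¬ G.2.Colorable 3) →
      (∀ (n m : ℕ) (G : SimpleGraph (Fin n)) (H : SimpleGraph (Fin m)), Nonempty (G →g H) →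
        (⟨n, G⟩ : FinGraph) ∈ C → (⟨m, H⟩ : FinGraph) ∈ C) →
      ∃ k : ℕ → ℕ, Filter.Tendsto (fun n : ℕ => (k n : ℝ) / n) Filter.atTop (nhds 0) ∧ ∀ᶠ n : ℕ in Filter.atTop, ∀ G : SimpleGraph (Fin n), (⟨n, G⟩ : FinGraph) ∈ C → ¬ (∃ E : MvPolynomial ℕ ℝ →ₗ[ℝ] ℝ, Literature.Computability.MetaComplexity.IsPseudoexpectation (2 * (k n)) E ∧ (∀ i : ℕ, Literature.Computability.MetaComplexity.SatisfiesIdentity (2 * (k n)) E (Literature.Computability.MetaComplexity.boolAxiom i)) ∧ (∀ v : Fin n, Literature.Computability.MetaComplexity.SatisfiesIdentity (2 * (k n)) E (1 - ∑ c : Fin 3, MvPolynomial.X (3 * v.val + c.val))) ∧ (∀ u v : Fin n, G.Adj u v → ∀ c : Fin 3, Literature.Computability.MetaComplexity.SatisfiesIdentity (2 * (k n)) E (MvPolynomial.X (3 * u.val + c.val) * MvPolynomial.X (3 * v.val + c.val))) ∧ ∀ p : Finset (Fin n) × (Fin n → Fin 3), p.1.card ≤ (k n) → (∀ v, v ∉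 p.1 → p.2 v = 0) → 0 < E (∏ v ∈ p.1, MvPolynomial.X (3 * v.val + (p.2 v).val)) → ∃ r : Finset (Fin n) → (Fin n → Fin 3) → ℤ, (∀ U t, r U t ≠ 0 → U.card ≤ (k n) ∧ (∀ v, v ∉ U → t v = 0) ∧ 0 < E (∏ v ∈ U, MvPolynomial.X (3 * v.val + (t v).val))) ∧ (∀ U D : Finset (Fin n), D ⊆ U → U.card ≤ (k n) → ∀ t' : Fin n → Fin 3, r D t' = ∑ t : Fin n → Fin 3, if (∀ v, t' v = if v ∈ D then t v else 0) then r U t else 0) ∧ r p.1 p.2 = 1 ∧ ∀ t, t ≠ p.2 → r p.1 t = 0)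

/-! ## The stubs (the ONLY sorries of this file) -/

theorem stub_cptDefinesHomRefuters : CptDefinesHomRefuters := by
  sorry

theorem stub_cptRefutersDominated : CptRefutersDominated := by
  sorry

/-! ## Name-keyed aliases of the stub statements (hypotheses of the composition) -/
namespace Registered

/-- Alias of `CptDefinesHomRefuters` keyed by the registered stub name. -/
abbrev stub_cptDefinesHomRefuters : Prop := CptDefinesHomRefuters
/-- Alias of `CptRefutersDominated` keyed by the registered stub name. -/
abbrev stub_cptRefutersDominated : Prop := CptRefutersDominated

end Registered

/-- COMPOSITION (kernel-checked, no sorry): the two stubs give the piece `CaptureHom` BY NAME. -/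
theorem CaptureHom_of (h₁ : Registered.stub_cptDefinesHomRefuters) (h₂ : Registered.stub_cptRefutersDominated) :
    Summit.PneNP.PneNP.Theses.DescentTower.CaptureHom := by
  unfold Registered.stub_cptDefinesHomRefuters CptDefinesHomRefuters at h₁
  unfold Registered.stub_cptRefutersDominated CptRefutersDominated at h₂
  intro R hP hs hm
  have hdef := h₁ R hP hs hm
  have hsC : ∀ G ∈ {G : FinGraph | Literature.Computability.Complexity.encodingGraph.encode G ∈ R},
      ¬ G.2.Colorable 3 := by
    rintro ⟨n, G⟩ hG
    exact hs n G hG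
  have hmC : ∀ (n m : ℕ) (G : SimpleGraph (Fin n)) (H : SimpleGraph (Fin m)), Nonempty (G →g H) →
      (⟨n, G⟩ : FinGraph) ∈ {G : FinGraph | Literature.Computability.Complexity.encodingGraph.encode G ∈ R} →
      (⟨m, H⟩ : FinGraph) ∈ {G : FinGraph | Literature.Computability.Complexity.encodingGraph.encode G ∈ R} :=
    fun n m G H hφ hG => hm n m G H hφ hG
  obtain ⟨k, hk, hdom⟩ := h₂ _ hdef hsC hmC
  exact ⟨k, hk, hdom.mono fun n hn G hG => hn G hG⟩

end Summit.PneNP.PneNP.Cruxes.CaptureHom.CptNormalForm
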